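import Summits.AnomalousDissipation.AnomalousDissipation.Theorems.UniformRelaxationWitness.Negative.RecurrentStates
import Summits.AnomalousDissipation.AnomalousDissipation.Theorems.RelaxingFamily.Negative.WeakScalarTimeDilation
import HarnessLib

/-!
# Sketch (ideator 4, crux-ideate round 2) — crux stmt-AnomalousDissipation-2937
# `LimitingAbsorption.UniformRelaxationWitness`: the DILATION CONJUGACY, run forward

Idea card `dilation-conjugacy-logsharp-jet-class` (Cruxes/UniformRelaxationWitness/Ideas/).

The kill side of this crux (refuters of r3, `RelaxingFamily/Negative/SublogBudget.lean`) dilates time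
by the enstrophy slope `M_j` to bring Seis' slope-1 theorem to bear. The SAME change of variables, run
in the proof direction, is an exact conjugacy of the crux's relaxation clause:

  (U_h) for (κ, u, C, γ·L)   ⟸   (U_h) for (κ/L, dilate L u, C, γ)       (`relaxesUniformlyFrom_of_dilate`)

where `dilate L u t = L⁻¹ • u (t/L)`. With `L_j := A log(1/ν_j)` (the Seis-minimal strain of a witness)
the dilated drifts have O(1) enstrophy, energy `O(1/log²)`, diffusivity `κ̃_j = ν_j/L_j`, and the crux's
ν-uniform `(C, γ)` becomes: prefactor `C` uniform and rate `γ/L_j ≍ (γ/A)/log(1/κ̃_j)` — i.e. EXACTLY the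
"dissipation enhancement on the optimal `|log κ|` time scale with κ-uniform prefactor" of
Elgindi–Liss–Mattingly (arXiv:2304.05374, Def. 1.1 + Thm. 1), asked of the S-odd sector only.
Hence `UniformRelaxationWitness` follows from a DILATED witness (`uniformRelaxationWitness_of_dilatedWitness`,
proved below, axioms standard), and the card splits the dilated witness into
K1 (kinematic ∀-theorem: a windowed hyperbolicity/dispersion certificate ⇒ log-sharp relaxation of S-odd
data) and K2 (scalar-free NS membership in the certificate class).

Everything in this file is sorry-free. The class predicate of K1/K2 is only OUTLINED at the end
(`LogLipschitzFamily`), because its Lagrangian-flow conjuncts need a flow-map API the tree does not have.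
-/

noncomputable section

open MeasureTheory Set Filter Function TopologicalSpace Topology
open scoped ENNReal NNReal InnerProductSpace

namespace Summit.AnomalousDissipation.AnomalousDissipation.Cruxes.UniformRelaxationWitness.DilationConjugacy

-- D-0017: single-problem summit ⇒ `Summit.AnomalousDissipation.AnomalousDissipation.…` by design.
set_option linter.dupNamespace false

open Literature.Analysis.FunctionSpaces Literature.Analysis.FunctionSpaces.Torus
open Literature.Analysis.FluidPDE Literature.Analysis.FluidPDE.Torus
open Summit.AnomalousDissipation.AnomalousDissipation.Theses.LimitingAbsorption
open Summit.AnomalousDissipation.AnomalousDissipation.Theorems.RelaxingFamily.Negative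
open Summit.AnomalousDissipation.AnomalousDissipation.Theorems.UniformRelaxationWitness.Negative

/-- The unit flat 2-torus (local notation). -/
local notation "𝕋²" => UnitAddTorus (Fin 2)
/-- Planar vectors (local notation). -/
local notation "E²" => EuclideanSpace ℝ (Fin 2)

/-! ## Dilation of a drift -/

/-- **Time dilation of a drift by the factor `L`**: `dilate L u t = L⁻¹ • u (L⁻¹ t)`. If `u` has
windowed strain `‖∇u‖ ≍ L` then `dilate L u` has O(1) strain, energy `‖u‖²/L²`, and one unit of
`u`-time is `L` units of dilated time; a scalar advected by `u` with diffusivity `κ` is, after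
`t ↦ L t`, a scalar advected by `dilate L u` with diffusivity `κ/L`
(`isWeakScalarTransportOn_comp_mul`). -/
def dilate (L : ℝ) (u : ℝ → 𝕋² → E²) : ℝ → 𝕋² → E² := fun t => L⁻¹ • u (L⁻¹ * t)

@[simp] theorem dilate_apply (L : ℝ) (u : ℝ → 𝕋² → E²) (t : ℝ) :
    dilate L u t = L⁻¹ • u (L⁻¹ * t) := rfl

/-! ## The conjugacy of the relaxation clause (FIRST LEMMA of the card) -/

/-- **Dilation conjugacy of `(U_h)` (proof direction).** If the dilated drift `dilate L u` relaxes the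
profile `h` at diffusivity `κ/L` from every phase with constants `(C, γ)`, then `u` relaxes `h` at
diffusivity `κ` from every phase with constants `(C, γ L)`: the equation released by `u` at phase `s` on
`[0,T)` is, after `t ↦ L t`, the equation released by `dilate L u` at phase `L s` on `[0, L T)`, with the
same datum; the a.e. bound transports back along `t ↦ L t`. (Kill-side twin: the slope dilation of
`relaxingFamily_false_without_logEnstrophy`.) [folklore] -/
theorem relaxesUniformlyFrom_of_dilate {κ L C γ : ℝ} {u : ℝ → 𝕋² → E²} {h : 𝕋² → ℝ} (hL : 0 < L)
    (hU : RelaxesUniformlyFrom (L⁻¹ * κ) (dilate L u) h C γ (Ici 0)) :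
    RelaxesUniformlyFrom κ u h C (γ * L) (Ici 0) := by
  intro s hs T θ hθ
  have hc : 0 < L⁻¹ := inv_pos.2 hL
  have hT : L⁻¹ * (L * T) = T := by rw [← mul_assoc, inv_mul_cancel₀ hL.ne', one_mul]
  have hθ' : IsWeakScalarTransportOn (L⁻¹ * (L * T)) κ (fun t => u (s + t)) h θ := by rwa [hT]
  have hdil := isWeakScalarTransportOn_comp_mul hc hθ'
  -- the dilated drift is `dilate L u` released at the phase `L s`
  have hdrift : (fun t => L⁻¹ • (fun t => u (s + t)) (L⁻¹ * t)) = fun t => dilate L u (L * s + t) := by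
    funext t
    simp only [dilate_apply]
    congr 2
    rw [mul_add, ← mul_assoc, inv_mul_cancel₀ hL.ne', one_mul]
  rw [hdrift] at hdil
  have hLs : L * s ∈ Ici (0 : ℝ) := mul_nonneg hL.le hs
  have hbound := hU (L * s) hLs (L * T) (fun t => θ (L⁻¹ * t)) hdil
  -- transport the a.e. bound back along `t ↦ L t`
  have h2 := ae_restrict_Ioo_comp_mul hL hbound
  filter_upwards [h2] with t ht
  have e1 : L⁻¹ * (L * t) = t := by rw [← mul_assoc, inv_mul_cancel₀ hL.ne', one_mul]
  have e2 : γ * (L * t) = γ * L * t := by ring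
  rwa [e1, e2] at ht

/-! ## The dilated witness and the transfer to the crux -/

/-- **Dilated witness.** The crux `UniformRelaxationWitness` with its relaxation clause replaced by the
clause for the DILATED drifts `dilate (L j) (v j)` at diffusivities `ν_j / L_j`, dilated rate `γ / L_j`
and the same prefactor `C` (level-dependent dilation factors `L_j > 0`; the card takes
`L_j = A log(1/ν_j)`, so that the dilated clause is log-sharp dissipation enhancement of the S-odd
profile with κ-uniform prefactor). -/
def DilatedWitness : Prop :=
  ∃ (g : 𝕋² → E²) (h : 𝕋² → ℝ), IsSmooth g ∧ IsDivFree g ∧ HasZeroMean g ∧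
    IsSmooth h ∧ HasZeroMean h ∧
    ∃ (ν : ℕ → ℝ) (v₀ : ℕ → 𝕋² → E²) (v : ℕ → ℝ → 𝕋² → E²),
      (∀ j, 0 < ν j) ∧ Tendsto ν atTop (𝓝 0) ∧
      (∀ j, IsGlobalLerayHopf (ν j) (fun _ => g) (v₀ j) (v j)) ∧
      (∀ j (T : ℝ), 0 < T →
        MemLp (stLift (v j)) ⊤ (volume.restrict (Ioo (0 : ℝ) T ×ˢ univ))) ∧
      (∃ E : ℝ, ∀ j, meanEnergy (v j) ≤ E) ∧
      (∃ (L : ℕ → ℝ) (C γ : ℝ), (∀ j, 0 < L j) ∧ 0 ≤ C ∧ 0 < γ ∧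
        ∀ j, RelaxesUniformlyFrom ((L j)⁻¹ * ν j) (dilate (L j) (v j)) h C (γ / L j) (Ici 0)) ∧
      ∃ ε : ℝ, 0 < ε ∧ ∀ j : ℕ, ∃ θ : ℝ → 𝕋² → ℝ,
        IsWeakScalarTransportForced (ν j) (v j) (fun _ => h) 0 θ ∧
        ε ≤ longTimeAvgSup (fun t => ν j * (eScalarGradNormSq (θ t)).toReal)

/-- **Transfer: a dilated witness is a witness of the crux** (undilate level by level with
`relaxesUniformlyFrom_of_dilate`; `(γ / L_j) · L_j = γ`). [folklore] -/
theorem uniformRelaxationWitness_of_dilatedWitness (hD : DilatedWitness) :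
    UniformRelaxationWitness := by
  obtain ⟨g, h, hg, hgd, hgm, hh, hhm, ν, v₀, v, hν, hνlim, hLH, hbd, hE, ⟨L, C, γ, hL, hC, hγ, hrel⟩,
    hfloor⟩ := hD
  refine ⟨g, h, hg, hgd, hgm, hh, hhm, ν, v₀, v, hν, hνlim, hLH, hbd, hE, ⟨C, γ, hC, hγ, ?_⟩, hfloor⟩
  intro j s hs T θ hθ
  have key := relaxesUniformlyFrom_of_dilate (hL j) (hrel j)
  have hγL : γ / L j * L j = γ := div_mul_cancel₀ γ (hL j).ne'
  rw [hγL] at key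
  exact key s (Set.mem_Ici.2 hs) T θ hθ

/-! ## Outline of the class predicate of K1/K2 (typed part only)

The kinematic certificate Π of the card has three conjuncts on a drift family; only the Eulerian one is
typed here (the Lagrangian ones — windowed backward finite-time-stretching large deviations and strip
dispersion — need flow maps of Lipschitz fields on `𝕋²`, not yet in the tree). -/

/-- **Log-Lipschitz strain budget from every phase** (Eulerian conjunct of the certificate): the drift
`v j t` is `B · L_j`-Lipschitz in space for every `t ≥ 0`, with `L_j = A log(1/ν_j)`. In dilated variables
(`dilate (L j) (v j)`) this is an O(1) Lipschitz bound — the regularity class in which `|log κ|` is the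
optimal dissipation time (Elgindi–Liss–Mattingly 2023, §1) and Seis' floor is met with room `B/…`. -/
def LogLipschitzFamily (A B : ℝ) (ν : ℕ → ℝ) (v : ℕ → ℝ → 𝕋² → E²) : Prop :=
  ∀ j (t : ℝ), 0 ≤ t → LipschitzWith (Real.toNNReal (B * (A * Real.log (ν j)⁻¹))) (v j t)

end Summit.AnomalousDissipation.AnomalousDissipation.Cruxes.UniformRelaxationWitness.DilationConjugacy

end
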